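import Mathlib
import Summits.Ventures.PercRepro2.RBDefs
import Summits.Ventures.PercRepro2.RBRoot
import Summits.Ventures.PercRepro2.RBRootDefs
import Summits.Ventures.PercRepro2.RBRootEdge
import Summits.Ventures.PercRepro2.RBRootEdgePin
import Summits.Ventures.PercRepro2.RBRootEdgeMain
import Summits.Ventures.PercRepro2.RBRootEdgeT
import Summits.Ventures.PercRepro2.RBRootIsolated
import Summits.Ventures.PercRepro2.RBTwoMarkers
import Summits.Ventures.PercRepro2.RBTwoMarkersCross
import Summits.Ventures.PercRepro2.BHKMixed
import Summits.Ventures.PercRepro2.RBMarkerEdge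
import Summits.Ventures.PercRepro2.RBMarkerEdgeMain
import Summits.Ventures.PercRepro2.RBMarkerDefs
import Summits.Ventures.PercRepro2.RBLeaf
import Summits.Ventures.PercRepro2.RBPendantW
import Summits.Ventures.PercRepro2.RBTwoMarkersMain
import Summits.Ventures.PercRepro2.RBTwoMarkersCrossMain
import Summits.Ventures.PercRepro2.RBKernel
import Summits.Ventures.PercRepro2.RBParallel
import Summits.Ventures.PercRepro2.RBKernelDefs
import Summits.Ventures.PercRepro2.RBPruneDefs
import Summits.Ventures.PercRepro2.RBKernelLeaf
import Summits.Ventures.PercRepro2.RBSeries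
import Summits.Ventures.PercRepro2.RBSeriesMain
import Summits.Ventures.PercRepro2.RBSeriesMass
import Summits.Ventures.PercRepro2.RBSeriesKernel
import Summits.Ventures.PercRepro2.RBReduceDefs
import Summits.Ventures.PercRepro2.RBReduce

/-!
# The typed row 2′RB at a third vertex with marked neighbours and ONE unmarked neighbour
(mine-a g6; MINE-A.md §38–§39)

Composition of the two reductions of this generation: every edge from `w` to `{s, t, b, o}` is
removable (`RB.RBcross_and_RBsame_of_unmarked`, §39) and a pendant third vertex reduces to its
neighbour (`RB.RBcross_and_RBsame_of_pendant_w`, §38). Hence the row holds at every `w ∉ {s,t,b,o}`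
whose nonzero-weight edges go to `{s, t, b, o}` and to ONE unmarked vertex `u` (through a single
edge `f`), provided the row holds at `u` for the weight vector with the marked edges at `w`
zeroed — in particular whenever that weight vector is skeleton-reducible at `u`
(`RB.RBcross_and_RBsame_of_marked_pendant_reducible`), e.g. `N(u) ⊆ {s, t, b, o, w}`: the
two-level star of MINE-A.md §38 (census 0 / 4,224) is a theorem.
-/

namespace Summit.Ventures.PercRepro2

namespace RB

open scoped Classical

variable {V : Type*} {E : Type*} [Fintype E] [DecidableEq E] [Fintype V] [DecidableEq V]
  {R : Type*} [Field R] [LinearOrder R] [IsStrictOrderedRing R]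

omit [Fintype E] [DecidableEq E] [Fintype V] in
/-- The weight vector with every edge between `w` and `{s, t, b, o}` zeroed is admissible. -/
lemma isProbVec_zeroMarked {p : E → R} (hp : IsProbVec p) (ends : E → Sym2 V) (o b s t w : V) :
    IsProbVec (fun e => if ends e = s(w, s) ∨ ends e = s(w, t) ∨ ends e = s(w, b) ∨
      ends e = s(w, o) then 0 else p e) :=
  ⟨fun e => by split_ifs; exacts [le_rfl, hp.nonneg e],
   fun e => by split_ifs; exacts [zero_le_one, hp.le_one e]⟩

/-- **Marked neighbours plus one unmarked neighbour**: if every nonzero-weight edge at `w` ends in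
`{s, t, b, o}` or is the edge `f = {w, u}` (`u ≠ w`; `u` may even be marked), both forms at `w` follow
from both forms at `u` for the weight vector with the marked edges at `w` zeroed. -/
theorem RBcross_and_RBsame_of_marked_pendant {p : E → R} (hp : IsProbVec p) (ends : E → Sym2 V)
    (o b s t w u : V) {f : E} (hends : ends f = s(w, u)) (huw : u ≠ w) (hws : w ≠ s) (hwt : w ≠ t)
    (hwb : w ≠ b) (hwo : w ≠ o)
    (H : ∀ e, w ∈ ends e → p e ≠ 0 →
      ends e = s(w, s) ∨ ends e = s(w, t) ∨ ends e = s(w, b) ∨ ends e = s(w, o) ∨ e = f)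
    (h : RBcross (fun e => if ends e = s(w, s) ∨ ends e = s(w, t) ∨ ends e = s(w, b) ∨
          ends e = s(w, o) then 0 else p e) ends o b s t u ∧
      RBsame (fun e => if ends e = s(w, s) ∨ ends e = s(w, t) ∨ ends e = s(w, b) ∨
          ends e = s(w, o) then 0 else p e) ends o b s t u) :
    RBcross p ends o b s t w ∧ RBsame p ends o b s t w := by
  refine RBcross_and_RBsame_of_unmarked hp ends o b s t w ?_
  refine RBcross_and_RBsame_of_pendant_w (isProbVec_zeroMarked hp ends o b s t w) ends o b s t w u
    hends huw hws hwt hwb hwo ?_ h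
  intro e he hpe
  by_cases hm : ends e = s(w, s) ∨ ends e = s(w, t) ∨ ends e = s(w, b) ∨ ends e = s(w, o)
  · exact absurd (if_pos hm) hpe
  · rw [if_neg hm] at hpe
    rcases H e he hpe with h1 | h2 | h3 | h4 | h5
    · exact absurd (Or.inl h1) hm
    · exact absurd (Or.inr (Or.inl h2)) hm
    · exact absurd (Or.inr (Or.inr (Or.inl h3))) hm
    · exact absurd (Or.inr (Or.inr (Or.inr h4))) hm
    · exact h5

/-- **The typed row at «marked neighbours + one unmarked neighbour of a skeleton-reducible
vertex»**: the two-level star of MINE-A.md §38 (`N(u) ⊆ {s, t, b, o, w}`) is the special case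
`Reducible.kernel`. -/
theorem RBcross_and_RBsame_of_marked_pendant_reducible {p : E → R} (hp : IsProbVec p)
    (ends : E → Sym2 V) (o b s t w u : V) {f : E} (hends : ends f = s(w, u)) (huw : u ≠ w)
    (hws : w ≠ s) (hwt : w ≠ t) (hwb : w ≠ b) (hwo : w ≠ o)
    (H : ∀ e, w ∈ ends e → p e ≠ 0 →
      ends e = s(w, s) ∨ ends e = s(w, t) ∨ ends e = s(w, b) ∨ ends e = s(w, o) ∨ e = f)
    (hr : Reducible ends s t b o u (fun e => if ends e = s(w, s) ∨ ends e = s(w, t) ∨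
      ends e = s(w, b) ∨ ends e = s(w, o) then 0 else p e)) :
    RBcross p ends o b s t w ∧ RBsame p ends o b s t w :=
  RBcross_and_RBsame_of_marked_pendant hp ends o b s t w u hends huw hws hwt hwb hwo
    H (RBcross_and_RBsame_of_reducible (isProbVec_zeroMarked hp ends o b s t w) ends o b s t u hr)

end RB

end Summit.Ventures.PercRepro2
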